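import Literature.Geometry.Lorentzian.MomentPartition
import Mathlib.MeasureTheory.Integral.MeanInequalities
import HarnessLib

/-!
# Moment-corrected splitting of a density along a chain of sets (linear bookkeeping for Lemma 2.2)

(trunk G08 = T-LORENTZ; family `gr`; namespace `Literature.Geometry.Lorentzian.MaoOhTao`.)

Mao–Oh–Tao (arXiv:2308.13031), proof of Lemma 2.2 (p. 9): a Bogovskiĭ-type operator on a union `U₁ ∪ U₂` is
`S f := S₁ f₁ + S₂ f₂` with the moment-corrected localisations `f_k = f χ_k − Σ_μ (∫ f χ_k g_μ) θ^μ`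
(`MomentPartition.lean`), and a finite union is handled "by a simple recursion".  This file unrolls the recursion into
closed form along a CHAIN `V₀, V₁, …, V_N` (consecutive sets overlapping), with FIXED cut-offs `φ_k` and FIXED bumps
`η_k` (supported in `V_k ∩ V_{k−1}`), so that everything is LINEAR in `f`:

* `chainMoment φ N f k μ = Σ_{k ≤ i ≤ N} ∫ f φ_i g_μ` — the moments of the tail mass;
* `chainPiece φ η N f k = f φ_k + Σ_μ M_{k+1}^μ θ^μ[η_{k+1}] − Σ_μ M_k^μ θ^μ[η_k]` (the first correction only for
  `k + 1 ≤ N`, the second only for `1 ≤ k`): the mass assigned to `V_k` — its own share `f φ_k`, plus the moments handed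
  down from the tail `V_{k+1}, …`, minus its tail moments handed to `V_{k−1}`.

Proved: linearity in `f`, support (`⊆ supp(f φ_k) ∪ supp η_{k+1} ∪ supp η_k`), continuity / `Cⁿ` regularity / compact
support, the telescoping identity `Σ_{k ≤ N} chainPiece f k = f Σ_{k ≤ N} φ_k`, and the moment identities (pieces
`k ≥ 1` are moment-free; piece `0` carries the moments of `f Σφ`).

## References

* Y. Mao, S.-J. Oh, T. Tao, arXiv:2308.13031 (2023), Lemma 2.2 and its proof, pp. 8–9 (key `MaoOhTao2023`).
-/

noncomputable section

open scoped RealInnerProductSpace Topology ENNReal ContDiff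
open Filter MeasureTheory Set Metric Function

namespace Literature.Geometry.Lorentzian

namespace MaoOhTao

variable {φ η : ℕ → E3 → ℝ} {N : ℕ} {f g : E3 → ℝ}

/-- **Tail moments** `M_k^μ = Σ_{k ≤ i ≤ N} ∫ f φ_i g_μ`. [cite: MaoOhTao2023, Lemma 2.2 (proof)] -/
def chainMoment (φ : ℕ → E3 → ℝ) (N : ℕ) (f : E3 → ℝ) (k : ℕ) (μ : Option (Fin 3)) : ℝ :=
  ∑ i ∈ Finset.Icc k N, ∫ y : E3, f y * φ i y * momentFn μ y

/-- **The mass assigned to the `k`-th set of the chain**: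
`f φ_k + [k + 1 ≤ N] Σ_μ M_{k+1}^μ θ^μ[η_{k+1}] − [1 ≤ k] Σ_μ M_k^μ θ^μ[η_k]`. [cite: MaoOhTao2023, Lemma 2.2 (proof)] -/
def chainPiece (φ η : ℕ → E3 → ℝ) (N : ℕ) (f : E3 → ℝ) (k : ℕ) (x : E3) : ℝ :=
  f x * φ k x + (if k + 1 ≤ N then ∑ μ, chainMoment φ N f (k + 1) μ * theta (η (k + 1)) μ x else 0) -
    (if 1 ≤ k then ∑ μ, chainMoment φ N f k μ * theta (η k) μ x else 0)

/-! ### Algebra of the tail moments -/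

/-- `M_k = m_k + M_{k+1}` for `k ≤ N` (with `M_{N+1} = 0`). [folklore] -/
theorem chainMoment_eq_add (φ : ℕ → E3 → ℝ) {N k : ℕ} (hk : k ≤ N) (f : E3 → ℝ) (μ : Option (Fin 3)) :
    chainMoment φ N f k μ = (∫ y : E3, f y * φ k y * momentFn μ y) + chainMoment φ N f (k + 1) μ := by
  simp only [chainMoment]
  have h : Finset.Icc k N = insert k (Finset.Icc (k + 1) N) := by
    ext i
    simp only [Finset.mem_Icc, Finset.mem_insert]
    omega
  rw [h, Finset.sum_insert]
  simp

/-- `M_{N+1} = 0`. [folklore] -/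
theorem chainMoment_succ_eq_zero (φ : ℕ → E3 → ℝ) (N : ℕ) (f : E3 → ℝ) (μ : Option (Fin 3)) :
    chainMoment φ N f (N + 1) μ = 0 := by
  simp [chainMoment]

/-- `M_0 = Σ_{i ≤ N} ∫ f φ_i g_μ = ∫ f (Σ_{i ≤ N} φ_i) g_μ` for `f ∈ C_c`, `φ_i` continuous. [folklore] -/
theorem chainMoment_zero_eq (hφ : ∀ i, Continuous (φ i)) (N : ℕ) (hf : Continuous f) (hfc : HasCompactSupport f)
    (μ : Option (Fin 3)) :
    chainMoment φ N f 0 μ = ∫ y : E3, f y * (∑ i ∈ Finset.range (N + 1), φ i y) * momentFn μ y := by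
  simp only [chainMoment]
  rw [show Finset.Icc 0 N = Finset.range (N + 1) from by ext i; simp]
  rw [← integral_finsetSum _ fun i _ ↦ integrable_mul_mul_momentFn hf hfc (hφ i) μ]
  refine integral_congr_ae (ae_of_all _ fun y ↦ ?_)
  simp only [Finset.mul_sum, Finset.sum_mul]

/-- Linearity of the tail moments in `f` (`f, g ∈ C_c`, `φ_i` continuous). [folklore] -/
theorem chainMoment_add_smul (hφ : ∀ i, Continuous (φ i)) (N : ℕ) (hf : Continuous f) (hfc : HasCompactSupport f)
    (hg : Continuous g) (hgc : HasCompactSupport g) (a b : ℝ) (k : ℕ) (μ : Option (Fin 3)) :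
    chainMoment φ N (fun x ↦ a * f x + b * g x) k μ = a * chainMoment φ N f k μ + b * chainMoment φ N g k μ := by
  simp only [chainMoment, Finset.mul_sum, ← Finset.sum_add_distrib]
  refine Finset.sum_congr rfl fun i _ ↦ ?_
  have h1 := integrable_mul_mul_momentFn hf hfc (hφ i) μ
  have h2 := integrable_mul_mul_momentFn hg hgc (hφ i) μ
  rw [← integral_const_mul, ← integral_const_mul, ← integral_add (h1.const_mul a) (h2.const_mul b)]
  refine integral_congr_ae (ae_of_all _ fun y ↦ ?_)
  simp only
  ring

/-! ### Linearity, support, regularity -/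

/-- **Linearity** of the pieces in `f` (`f, g ∈ C_c`, `φ_i` continuous). [cite: MaoOhTao2023, Lemma 2.2 (proof)] -/
theorem chainPiece_add_smul (hφ : ∀ i, Continuous (φ i)) (η : ℕ → E3 → ℝ) (N : ℕ) (hf : Continuous f)
    (hfc : HasCompactSupport f) (hg : Continuous g) (hgc : HasCompactSupport g) (a b : ℝ) (k : ℕ) (x : E3) :
    chainPiece φ η N (fun x ↦ a * f x + b * g x) k x = a * chainPiece φ η N f k x + b * chainPiece φ η N g k x := by
  simp only [chainPiece, chainMoment_add_smul hφ N hf hfc hg hgc]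
  split_ifs <;> simp only [add_mul, Finset.sum_add_distrib, mul_assoc, ← Finset.mul_sum] <;> ring

/-- The pieces vanish wherever `f φ_k`, `η_{k+1}` (if `k + 1 ≤ N`) and `η_k` (if `1 ≤ k`) vanish. [folklore] -/
theorem chainPiece_eq_zero (φ η : ℕ → E3 → ℝ) (N : ℕ) (f : E3 → ℝ) (k : ℕ) {x : E3} (h0 : f x * φ k x = 0)
    (h1 : k + 1 ≤ N → η (k + 1) x = 0) (h2 : 1 ≤ k → η k x = 0) : chainPiece φ η N f k x = 0 := by
  simp only [chainPiece, h0, zero_add]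
  have e1 : (if k + 1 ≤ N then ∑ μ, chainMoment φ N f (k + 1) μ * theta (η (k + 1)) μ x else 0) = 0 := by
    split_ifs with hk
    · simp [theta_eq_zero_of_eta _ _ (h1 hk)]
    · rfl
  have e2 : (if 1 ≤ k then ∑ μ, chainMoment φ N f k μ * theta (η k) μ x else 0) = 0 := by
    split_ifs with hk
    · simp [theta_eq_zero_of_eta _ _ (h2 hk)]
    · rfl
  rw [e1, e2, sub_zero]

/-- **Support of the pieces** in a set `V`: if `f φ_k`, `η_{k+1}` and `η_k` vanish off `V`, so does the piece.
[cite: MaoOhTao2023, Lemma 2.2 (proof)] -/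
theorem chainPiece_eq_zero_of_notMem (φ η : ℕ → E3 → ℝ) (N : ℕ) (f : E3 → ℝ) (k : ℕ) {V : Set E3}
    (h0 : ∀ x, x ∉ V → f x * φ k x = 0) (h1 : k + 1 ≤ N → ∀ x, x ∉ V → η (k + 1) x = 0)
    (h2 : 1 ≤ k → ∀ x, x ∉ V → η k x = 0) {x : E3} (hx : x ∉ V) : chainPiece φ η N f k x = 0 :=
  chainPiece_eq_zero φ η N f k (h0 x hx) (fun hk ↦ h1 hk x hx) (fun hk ↦ h2 hk x hx)

/-- **Continuity** of the pieces. [folklore] -/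
theorem continuous_chainPiece (hφ : ∀ i, Continuous (φ i)) (hη : ∀ i, Continuous (η i)) (N : ℕ)
    (hf : Continuous f) (k : ℕ) : Continuous (chainPiece φ η N f k) := by
  unfold chainPiece
  refine ((hf.mul (hφ k)).add ?_).sub ?_
  · split_ifs
    · exact continuous_finsetSum _ fun μ _ ↦ continuous_const.mul (continuous_theta (hη _) μ)
    · exact continuous_const
  · split_ifs
    · exact continuous_finsetSum _ fun μ _ ↦ continuous_const.mul (continuous_theta (hη _) μ)
    · exact continuous_const

/-- **`Cⁿ` regularity** of the pieces (`f, φ_k, η_k ∈ Cⁿ`). [folklore] -/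
theorem contDiff_chainPiece {n : ℕ∞ω} (hφ : ∀ i, ContDiff ℝ n (φ i)) (hη : ∀ i, ContDiff ℝ n (η i)) (N : ℕ)
    (hf : ContDiff ℝ n f) (k : ℕ) : ContDiff ℝ n (chainPiece φ η N f k) := by
  unfold chainPiece
  refine ((hf.mul (hφ k)).add ?_).sub ?_
  · split_ifs
    · exact ContDiff.sum fun μ _ ↦ contDiff_const.mul (contDiff_theta (hη _) μ)
    · exact contDiff_const
  · split_ifs
    · exact ContDiff.sum fun μ _ ↦ contDiff_const.mul (contDiff_theta (hη _) μ)
    · exact contDiff_const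

/-- **Compact support** of the pieces (`f` and the `η_k` compactly supported). [folklore] -/
theorem hasCompactSupport_chainPiece (φ : ℕ → E3 → ℝ) (hηc : ∀ i, HasCompactSupport (η i)) (N : ℕ)
    (hfc : HasCompactSupport f) (k : ℕ) : HasCompactSupport (chainPiece φ η N f k) := by
  refine HasCompactSupport.intro ((hfc.union (hηc (k + 1))).union (hηc k)) fun x hx ↦ ?_
  simp only [mem_union, not_or] at hx
  obtain ⟨⟨h0, h1⟩, h2⟩ := hx
  exact chainPiece_eq_zero φ η N f k (by rw [image_eq_zero_of_notMem_tsupport h0, zero_mul])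
    (fun _ ↦ image_eq_zero_of_notMem_tsupport h1) (fun _ ↦ image_eq_zero_of_notMem_tsupport h2)

/-! ### Telescoping and moments -/

/-- **Telescoping**: `Σ_{k ≤ N} chainPiece f k = f · Σ_{k ≤ N} φ_k` (the handed-down corrections cancel in pairs).
[cite: MaoOhTao2023, Lemma 2.2 (proof)] -/
theorem sum_chainPiece_eq (φ η : ℕ → E3 → ℝ) (N : ℕ) (f : E3 → ℝ) (x : E3) :
    ∑ k ∈ Finset.range (N + 1), chainPiece φ η N f k x = f x * ∑ k ∈ Finset.range (N + 1), φ k x := by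
  set A : ℕ → ℝ := fun k ↦ if 1 ≤ k ∧ k ≤ N then ∑ μ, chainMoment φ N f k μ * theta (η k) μ x else 0 with hA
  have hpiece : ∀ k ∈ Finset.range (N + 1), chainPiece φ η N f k x = f x * φ k x + (A (k + 1) - A k) := by
    intro k hk
    rw [Finset.mem_range, Nat.lt_succ_iff] at hk
    simp only [chainPiece, hA]
    have e1 : (if k + 1 ≤ N then ∑ μ, chainMoment φ N f (k + 1) μ * theta (η (k + 1)) μ x else 0) =
        if 1 ≤ k + 1 ∧ k + 1 ≤ N then ∑ μ, chainMoment φ N f (k + 1) μ * theta (η (k + 1)) μ x else 0 := by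
      by_cases h : k + 1 ≤ N
      · rw [if_pos h, if_pos ⟨by omega, h⟩]
      · rw [if_neg h, if_neg (fun h' ↦ h h'.2)]
    have e2 : (if 1 ≤ k then ∑ μ, chainMoment φ N f k μ * theta (η k) μ x else 0) =
        if 1 ≤ k ∧ k ≤ N then ∑ μ, chainMoment φ N f k μ * theta (η k) μ x else 0 := by
      by_cases h : 1 ≤ k
      · rw [if_pos h, if_pos ⟨h, hk⟩]
      · rw [if_neg h, if_neg (fun h' ↦ h h'.1)]
    rw [e1, e2]
    ring
  rw [Finset.sum_congr rfl hpiece, Finset.sum_add_distrib, Finset.sum_range_sub A, Finset.mul_sum]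
  have hA0 : A 0 = 0 := by simp [hA]
  have hAN : A (N + 1) = 0 := by
    simp only [hA]
    rw [if_neg]
    omega
  rw [hA0, hAN, sub_zero, add_zero]

/-- If `Σ_{k ≤ N} φ_k = 1` on `supp f`, the pieces sum to `f`. [cite: MaoOhTao2023, Lemma 2.2 (proof)] -/
theorem sum_chainPiece_eq_self (φ η : ℕ → E3 → ℝ) (N : ℕ) (f : E3 → ℝ)
    (hsum : ∀ x, f x ≠ 0 → ∑ k ∈ Finset.range (N + 1), φ k x = 1) (x : E3) :
    ∑ k ∈ Finset.range (N + 1), chainPiece φ η N f k x = f x := by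
  rw [sum_chainPiece_eq]
  by_cases hx : f x = 0
  · rw [hx, zero_mul]
  · rw [hsum x hx, mul_one]

/-- Integrability of `chainPiece · g_μ`. [folklore] -/
theorem integrable_chainPiece_mul_momentFn (hφ : ∀ i, Continuous (φ i)) (hη : ∀ i, Continuous (η i))
    (hηc : ∀ i, HasCompactSupport (η i)) (N : ℕ) (hf : Continuous f) (hfc : HasCompactSupport f) (k : ℕ)
    (μ : Option (Fin 3)) : Integrable fun x : E3 ↦ chainPiece φ η N f k x * momentFn μ x :=
  ((continuous_chainPiece hφ hη N hf k).mul (continuous_momentFn μ)).integrable_of_hasCompactSupport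
    (hasCompactSupport_chainPiece φ hηc N hfc k).mul_right

/-- A correction sum `Σ_μ c_μ θ^μ[ζ]` has compact support. [folklore] -/
theorem hasCompactSupport_sum_mul_theta {ζ : E3 → ℝ} (hζc : HasCompactSupport ζ) (c : Option (Fin 3) → ℝ) :
    HasCompactSupport fun x : E3 ↦ ∑ μ, c μ * theta ζ μ x := by
  refine HasCompactSupport.intro hζc fun x hx ↦ ?_
  simp [theta_eq_zero_of_eta _ _ (image_eq_zero_of_notMem_tsupport hx)]

/-- Moments of a correction sum: `∫ (Σ_μ c_μ θ^μ[ζ]) g_{μ'} = c_{μ'}`. [folklore] -/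
theorem integral_sum_mul_theta_mul_momentFn {ζ : E3 → ℝ} (hζ : Continuous ζ) (hζc : HasCompactSupport ζ) {x₀ : E3}
    (hx₀ : ζ x₀ ≠ 0) (c : Option (Fin 3) → ℝ) (μ' : Option (Fin 3)) :
    ∫ x : E3, (∑ μ, c μ * theta ζ μ x) * momentFn μ' x = c μ' := by
  have h2 : ∀ μ, Integrable fun x : E3 ↦ c μ * (theta ζ μ x * momentFn μ' x) := fun μ ↦
    (((continuous_theta hζ μ).mul (continuous_momentFn μ')).integrable_of_hasCompactSupport
      (hasCompactSupport_theta hζc μ).mul_right).const_mul _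
  have e1 : (fun x : E3 ↦ (∑ μ, c μ * theta ζ μ x) * momentFn μ' x) =
      fun x ↦ ∑ μ, c μ * (theta ζ μ x * momentFn μ' x) := by
    funext x
    rw [Finset.sum_mul]
    exact Finset.sum_congr rfl fun μ _ ↦ by ring
  rw [e1, integral_finsetSum _ fun μ _ ↦ h2 μ]
  simp only [integral_const_mul, integral_theta_mul_momentFn hζ hζc hx₀, mul_ite, mul_one, mul_zero,
    Finset.sum_ite_eq', Finset.mem_univ, if_true]

/-- Integrability of a correction sum against `g_μ`. [folklore] -/
theorem integrable_sum_mul_theta_mul_momentFn {ζ : E3 → ℝ} (hζ : Continuous ζ) (hζc : HasCompactSupport ζ)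
    (c : Option (Fin 3) → ℝ) (μ : Option (Fin 3)) :
    Integrable fun x : E3 ↦ (∑ ν, c ν * theta ζ ν x) * momentFn μ x :=
  ((continuous_finsetSum _ fun ν _ ↦ continuous_const.mul (continuous_theta hζ ν)).mul
    (continuous_momentFn μ)).integrable_of_hasCompactSupport (hasCompactSupport_sum_mul_theta hζc c).mul_right

/-- **The pieces `k ≥ 1` are moment-free**: `∫ chainPiece f k g_μ = m_k + M_{k+1} − M_k = 0` (`1 ≤ k ≤ N`), provided
each bump `η_i` (`1 ≤ i ≤ N`) is nonzero somewhere. [cite: MaoOhTao2023, Lemma 2.2 (proof)] -/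
theorem integral_chainPiece_mul_momentFn_eq_zero (hφ : ∀ i, Continuous (φ i)) (hη : ∀ i, Continuous (η i))
    (hηc : ∀ i, HasCompactSupport (η i)) {p : ℕ → E3} (hp : ∀ i, 1 ≤ i → i ≤ N → η i (p i) ≠ 0)
    (hf : Continuous f) (hfc : HasCompactSupport f) {k : ℕ} (hk1 : 1 ≤ k) (hkN : k ≤ N) (μ : Option (Fin 3)) :
    ∫ x : E3, chainPiece φ η N f k x * momentFn μ x = 0 := by
  have I0 : Integrable fun x : E3 ↦ f x * φ k x * momentFn μ x := integrable_mul_mul_momentFn hf hfc (hφ k) μ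
  have Ith : ∀ (i : ℕ) (c : Option (Fin 3) → ℝ),
      Integrable fun x : E3 ↦ (∑ ν, c ν * theta (η i) ν x) * momentFn μ x := fun i c ↦
    integrable_sum_mul_theta_mul_momentFn (hη i) (hηc i) c μ
  by_cases hkN' : k + 1 ≤ N
  · have e : (fun x : E3 ↦ chainPiece φ η N f k x * momentFn μ x) = fun x ↦
        f x * φ k x * momentFn μ x + (∑ ν, chainMoment φ N f (k + 1) ν * theta (η (k + 1)) ν x) * momentFn μ x -
          (∑ ν, chainMoment φ N f k ν * theta (η k) ν x) * momentFn μ x := by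
      funext x
      simp only [chainPiece, if_pos hkN', if_pos hk1]
      ring
    have I01 : Integrable fun x : E3 ↦ f x * φ k x * momentFn μ x +
        (∑ ν, chainMoment φ N f (k + 1) ν * theta (η (k + 1)) ν x) * momentFn μ x := I0.add (Ith _ _)
    rw [e, integral_sub I01 (Ith _ _), integral_add I0 (Ith _ _),
      integral_sum_mul_theta_mul_momentFn (hη _) (hηc _) (hp (k + 1) (by omega) hkN') _ μ,
      integral_sum_mul_theta_mul_momentFn (hη _) (hηc _) (hp k hk1 hkN) _ μ, chainMoment_eq_add φ hkN f μ]
    ring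
  · have hkN2 : k = N := by omega
    have e : (fun x : E3 ↦ chainPiece φ η N f k x * momentFn μ x) = fun x ↦
        f x * φ k x * momentFn μ x - (∑ ν, chainMoment φ N f k ν * theta (η k) ν x) * momentFn μ x := by
      funext x
      simp only [chainPiece, if_neg hkN', if_pos hk1, add_zero]
      ring
    rw [e, integral_sub I0 (Ith _ _), integral_sum_mul_theta_mul_momentFn (hη _) (hηc _) (hp k hk1 hkN) _ μ,
      chainMoment_eq_add φ hkN f μ, hkN2, chainMoment_succ_eq_zero]
    ring

/-- **The piece `0` carries all the moments**: `∫ chainPiece f 0 g_μ = M_0 = ∫ f (Σ_{i ≤ N} φ_i) g_μ`.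
[cite: MaoOhTao2023, Lemma 2.2 (proof)] -/
theorem integral_chainPiece_zero_mul_momentFn (hφ : ∀ i, Continuous (φ i)) (hη : ∀ i, Continuous (η i))
    (hηc : ∀ i, HasCompactSupport (η i)) {p : ℕ → E3} (hp : ∀ i, 1 ≤ i → i ≤ N → η i (p i) ≠ 0)
    (hf : Continuous f) (hfc : HasCompactSupport f) (μ : Option (Fin 3)) :
    ∫ x : E3, chainPiece φ η N f 0 x * momentFn μ x =
      ∫ y : E3, f y * (∑ i ∈ Finset.range (N + 1), φ i y) * momentFn μ y := by
  have I0 : Integrable fun x : E3 ↦ f x * φ 0 x * momentFn μ x := integrable_mul_mul_momentFn hf hfc (hφ 0) μ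
  have Ith : ∀ (i : ℕ) (c : Option (Fin 3) → ℝ),
      Integrable fun x : E3 ↦ (∑ ν, c ν * theta (η i) ν x) * momentFn μ x := fun i c ↦
    integrable_sum_mul_theta_mul_momentFn (hη i) (hηc i) c μ
  rw [← chainMoment_zero_eq hφ N hf hfc μ]
  have h10 : ¬ (1 ≤ 0) := Nat.not_succ_le_zero 0
  by_cases hN : 0 + 1 ≤ N
  · have e : (fun x : E3 ↦ chainPiece φ η N f 0 x * momentFn μ x) = fun x ↦
        f x * φ 0 x * momentFn μ x + (∑ ν, chainMoment φ N f 1 ν * theta (η 1) ν x) * momentFn μ x := by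
      funext x
      simp only [chainPiece, if_pos hN, h10, if_false, sub_zero]
      ring
    rw [e, integral_add I0 (Ith _ _), integral_sum_mul_theta_mul_momentFn (hη _) (hηc _) (hp 1 le_rfl hN) _ μ,
      chainMoment_eq_add φ (Nat.zero_le N) f μ]
  · have hN0 : N = 0 := by omega
    have e : (fun x : E3 ↦ chainPiece φ η N f 0 x * momentFn μ x) = fun x ↦ f x * φ 0 x * momentFn μ x := by
      funext x
      simp only [chainPiece, if_neg hN, h10, if_false, sub_zero, add_zero]
    rw [e, chainMoment_eq_add φ (Nat.zero_le N) f μ, hN0, chainMoment_succ_eq_zero, add_zero]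

/-- **Moment-free `f` gives a moment-free piece `0`** (when `Σφ = 1` on `supp f`).
[cite: MaoOhTao2023, Lemma 2.2 (proof)] -/
theorem integral_chainPiece_zero_mul_momentFn_eq_zero (hφ : ∀ i, Continuous (φ i)) (hη : ∀ i, Continuous (η i))
    (hηc : ∀ i, HasCompactSupport (η i)) {p : ℕ → E3} (hp : ∀ i, 1 ≤ i → i ≤ N → η i (p i) ≠ 0)
    (hf : Continuous f) (hfc : HasCompactSupport f) (hsum : ∀ x, f x ≠ 0 → ∑ k ∈ Finset.range (N + 1), φ k x = 1)
    (hmom : ∀ μ, ∫ y : E3, f y * momentFn μ y = 0) (μ : Option (Fin 3)) :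
    ∫ x : E3, chainPiece φ η N f 0 x * momentFn μ x = 0 := by
  rw [integral_chainPiece_zero_mul_momentFn hφ hη hηc hp hf hfc μ, ← hmom μ]
  refine integral_congr_ae (ae_of_all _ fun y ↦ ?_)
  by_cases hy : f y = 0
  · simp [hy]
  · simp only [hsum y hy, mul_one]

/-- **All pieces are moment-free for moment-free `f`** (`k ≤ N`, `Σφ = 1` on `supp f`).
[cite: MaoOhTao2023, Lemma 2.2 (proof)] -/
theorem integral_chainPiece_mul_momentFn_eq_zero_of_moments (hφ : ∀ i, Continuous (φ i))
    (hη : ∀ i, Continuous (η i)) (hηc : ∀ i, HasCompactSupport (η i)) {p : ℕ → E3}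
    (hp : ∀ i, 1 ≤ i → i ≤ N → η i (p i) ≠ 0) (hf : Continuous f) (hfc : HasCompactSupport f)
    (hsum : ∀ x, f x ≠ 0 → ∑ k ∈ Finset.range (N + 1), φ k x = 1) (hmom : ∀ μ, ∫ y : E3, f y * momentFn μ y = 0)
    {k : ℕ} (hk : k ≤ N) (μ : Option (Fin 3)) : ∫ x : E3, chainPiece φ η N f k x * momentFn μ x = 0 := by
  rcases Nat.eq_zero_or_pos k with h0 | hpos
  · subst h0
    exact integral_chainPiece_zero_mul_momentFn_eq_zero hφ hη hηc hp hf hfc hsum hmom μ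
  · exact integral_chainPiece_mul_momentFn_eq_zero hφ hη hηc hp hf hfc hpos hk μ

end MaoOhTao

end Literature.Geometry.Lorentzian
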